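import Mathlib
import Literature.NumberTheory.NumberFields.PureCubicClassNumberModThreeProofs
import HarnessLib

/-!
# Local non-norm lemma: `ζ₃` is not a norm at a totally ramified prime with `9 ∤ N𝔭 − 1`

The decisive arithmetic input of Chevalley's ambiguous-class argument for the cyclic cubic
extension `L = K(ζ₃) ⊇ F = ℚ(ζ₃)` (the `(2,5)`-direction of Honda's criterion) is that `ζ₃` is not
a norm from `L`.  The obstruction is local and generic: let `L/F` be a Galois extension of number
fields of degree `3`, `ζ ∈ 𝓞 F` a primitive cube root of unity, and `P` a maximal ideal of `𝓞 L`
totally ramified over `𝔭 = P ∩ 𝓞 F` (`e(P|𝔭) = 3`, hence `f(P|𝔭) = 1` and the inertia group of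
`P` is all of `Gal(L/F)`, i.e. every `σ` acts trivially on `𝓞 L ⁄ P`).  If `3 ∉ 𝔭` and
`9 ∤ N𝔭 − 1` then no `x ∈ L` has `N_{L/F}(x) = ζ`: such an `x` is a `P`-adic unit
(`v_P ∘ N = 3 v_P`), so `x = n/d` with `d ∉ P`, and `N(y) ≡ y³ (mod P)` for `y ∈ 𝓞 L` gives
`ζ ≡ (n/d)³` in the residue field `𝓞 L ⁄ P ≅ 𝓞 F ⁄ 𝔭`; but `ζ mod P` has order `3` (`3 ∉ P`),
so `n/d` has order `9` and `9 ∣ #(𝓞 F ⁄ 𝔭) − 1`.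

The valuation bookkeeping (`valuation_eq_one_of_norm_eq_unit`) is the tree's
`Literature.NumberTheory.NumberFields.Honda1971`; here we replace its concrete residue-field
hypotheses (`#(𝓞 L ⁄ P) = p^f`, `p ≡ 2, 5 (mod 9)`) by the abstract ones of the skeleton.
-/

noncomputable section

open NumberField IsDedekindDomain

open scoped Pointwise NumberField

namespace Summit.QuantumAdvantage.QuantumAdvantage.Theorems.LinnikCubicClassGroups

open Literature.NumberTheory.NumberFields Literature.NumberTheory.NumberFields.Honda1971

/-- A root `ω` of `X² + X + 1` keeps multiplicative order `3` modulo every prime ideal `P` not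
containing `3`: `ω ≡ 1 (mod P)` would give `3ω = (ω² + ω + 1) − (ω − 1)² ∈ P`, and `ω` is a
unit. (Variant of the tree's `Honda1971.orderOf_mk_eq_three` with the hypothesis `3 ∉ P` in
place of a rational prime `p ∈ P` coprime to `3`.) [folklore] -/
theorem orderOf_mk_eq_three_of_notMem {R : Type*} [CommRing R] {ω : R}
    (hω : ω ^ 2 + ω + 1 = 0) (P : Ideal R) [hP : P.IsPrime] (h3 : (3 : R) ∉ P) :
    orderOf (Ideal.Quotient.mk P ω) = 3 := by
  have hω3 : ω ^ 3 = 1 := by linear_combination (ω - 1) * hω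
  refine orderOf_eq_prime ?_ ?_
  · rw [← map_pow, hω3, map_one]
  · intro h1
    have hmem : ω - 1 ∈ P := by
      rw [← Ideal.Quotient.eq, h1, map_one]
    have h3ω : (3 : R) * ω ∈ P := by
      have h : (3 : R) * ω = (ω ^ 2 + ω + 1) - (ω - 1) * (ω - 1) := by ring
      rw [h, hω, zero_sub]
      exact P.neg_mem (P.mul_mem_left (ω - 1) hmem)
    have hωP : ω ∉ P := fun h => hP.ne_top ((Ideal.eq_top_iff_one _).mpr (by
      have h' : ω ^ 3 ∈ P := P.pow_mem_of_mem h 3 (by norm_num)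
      rwa [hω3] at h'))
    exact h3 ((hP.mem_or_mem h3ω).resolve_right hωP)

/-- In a finite field, an element of order `3` which is a cube `c³` forces `c` to have order `9`,
hence `9 ∣ #K − 1 = #Kˣ`. [folklore] -/
theorem nine_dvd_card_sub_one_of_pow_three_eq {K : Type*} [Field K] [Fintype K] {ω : K}
    (hω : orderOf ω = 3) {c : K} (hc : c ^ 3 = ω) : 9 ∣ Fintype.card K - 1 := by
  classical
  have hω1 : ω ≠ 1 := by
    rintro rfl
    rw [orderOf_one] at hω
    omega
  have hc0 : c ≠ 0 := by
    rintro rfl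
    rw [zero_pow three_ne_zero] at hc
    have h := pow_orderOf_eq_one ω
    rw [hω, ← hc, zero_pow three_ne_zero] at h
    exact zero_ne_one h
  -- `c` has order `9 = 3²`
  have hc9 : orderOf c = 9 := by
    have h := orderOf_eq_prime_pow (p := 3) (n := 1) (x := c)
      (by rw [pow_one, hc]; exact hω1)
      (by rw [show 3 ^ (1 + 1) = 3 * 3 by norm_num, pow_mul, hc, ← hω, pow_orderOf_eq_one])
    rw [h]
    norm_num
  -- hence `9 ∣ #Kˣ = #K - 1`
  have hu : orderOf (Units.mk0 c hc0) = 9 := by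
    rw [← orderOf_units, Units.val_mk0, hc9]
  have h := orderOf_dvd_card (x := Units.mk0 c hc0)
  rwa [hu, Fintype.card_units] at h

/-- **Total ramification means the inertia group is everything.**  For `L/F` Galois of degree `3`
and a maximal ideal `P` of `𝓞 L` with `e(P | P ∩ 𝓞 F) = 3`, the inertia group of `P` has order
`3 = #Gal(L/F)`, so every `σ ∈ Gal(L/F)` acts trivially modulo `P`. [folklore] -/
theorem smul_sub_mem_of_ramificationIdx_eq_three {F L : Type*} [Field F] [NumberField F]
    [Field L] [NumberField L] [Algebra F L] [IsGalois F L] (h3 : Module.finrank F L = 3)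
    (P : Ideal (𝓞 L)) [P.IsMaximal] (he : P.ramificationIdx (𝓞 F) = 3)
    (σ : L ≃ₐ[F] L) (x : 𝓞 L) : σ • x - x ∈ P := by
  have hcard : Nat.card (P.inertia (L ≃ₐ[F] L)) = Nat.card (L ≃ₐ[F] L) := by
    rw [card_inertia_eq_ramificationIdx L (L ≃ₐ[F] L) F P, he, IsGalois.card_aut_eq_finrank, h3]
  have htop : P.inertia (L ≃ₐ[F] L) = ⊤ := Subgroup.eq_top_of_card_eq _ hcard
  have hσ : σ ∈ P.inertia (L ≃ₐ[F] L) := htop ▸ Subgroup.mem_top σ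
  exact hσ x

/-- **Total ramification means residue degree one.**  For `L/F` Galois of degree `3` and a
maximal ideal `P` of `𝓞 L` with `e(P | 𝔭) = 3`, `𝔭 = P ∩ 𝓞 F`, the fundamental identity
`g · e · f = 3` forces `f(P|𝔭) = 1`, i.e. `#(𝓞 L ⁄ P) = #(𝓞 F ⁄ 𝔭)`. [folklore] -/
theorem card_quot_eq_of_ramificationIdx_eq_three {F L : Type*} [Field F] [NumberField F]
    [Field L] [NumberField L] [Algebra F L] [IsGalois F L] (h3 : Module.finrank F L = 3)
    (P : Ideal (𝓞 L)) [P.IsMaximal] (he : P.ramificationIdx (𝓞 F) = 3) :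
    Nat.card (𝓞 L ⧸ P) = Nat.card (𝓞 F ⧸ P.under (𝓞 F)) := by
  classical
  haveI : (P.under (𝓞 F)).IsMaximal := Ideal.IsMaximal.under (𝓞 F) P
  have h := Ideal.ncard_primesOver_mul_ramificationIdxIn_mul_inertiaDegIn (P.under (𝓞 F)) (𝓞 L)
    (L ≃ₐ[F] L)
  rw [IsGalois.card_aut_eq_finrank, h3,
    Ideal.ramificationIdxIn_eq_ramificationIdx (P.under (𝓞 F)) P (L ≃ₐ[F] L), he,
    Ideal.inertiaDegIn_eq_inertiaDeg (P.under (𝓞 F)) P (L ≃ₐ[F] L)] at h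
  -- `g · (3 · f) = 3` forces `f = 1`
  have hf : P.inertiaDeg (𝓞 F) = 1 := by
    have h' : ((P.under (𝓞 F)).primesOver (𝓞 L)).ncard * P.inertiaDeg (𝓞 F) = 1 := by
      have h'' : 3 * (((P.under (𝓞 F)).primesOver (𝓞 L)).ncard * P.inertiaDeg (𝓞 F)) = 3 * 1 := by
        rw [mul_one, ← mul_left_comm, h]
      exact Nat.eq_of_mul_eq_mul_left (by norm_num) h''
    exact Nat.eq_one_of_mul_eq_one_left h'
  have hc := Ideal.cardQuot_pow_inertiaDeg (P.under (𝓞 F)) P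
  rw [hf, pow_one, Submodule.cardQuot_apply, Submodule.cardQuot_apply] at hc
  exact hc.symm

/-- **LOCAL NON-NORM** (stub `stub_zetaNotNorm` of the line): in a Galois cubic extension `L/F` of
number fields, if a maximal ideal `P` of `𝓞 L` is totally ramified over `𝔭 = P ∩ 𝓞 F`
(`e = 3`), `3 ∉ 𝔭` and `9 ∤ N𝔭 − 1`, then a primitive cube root of unity `ζ ∈ 𝓞 F` is not a
norm from `L`.  (If `N x = ζ` then `x` is a `P`-unit, `x = n/d` with `d ∉ P`; as `Gal(L/F)` acts
trivially modulo `P`, `N y ≡ y³ (mod P)`, so `ζ ≡ (n/d)³` in `𝓞 L ⁄ P ≅ 𝓞 F ⁄ 𝔭`, where `ζ`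
has order `3`: an element of order `9` in a group of order `N𝔭 − 1`.)  The hypothesis that `P³`
is principal from `F` is not used. [folklore] -/
theorem stub_zetaNotNorm :
    ∀ (F L : Type) [Field F] [NumberField F] [Field L] [NumberField L] [Algebra F L]
      [IsGalois F L], Module.finrank F L = 3 →
      ∀ (ζ : 𝓞 F), (ζ : F) ^ 3 = 1 → (ζ : F) ≠ 1 →
      ∀ (P : Ideal (𝓞 L)), P.IsMaximal →
        P.ramificationIdx (𝓞 F) = 3 →
        (∃ t : 𝓞 F, Ideal.span {algebraMap (𝓞 F) (𝓞 L) t} = P ^ 3) →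
        (3 : 𝓞 F) ∉ P.under (𝓞 F) →
        ¬ 9 ∣ Nat.card ((𝓞 F) ⧸ P.under (𝓞 F)) - 1 →
        ∀ x : L, Algebra.norm F x ≠ (ζ : F) := by
  intro F L _ _ _ _ _ _ h3 ζ hζ3 hζ1 P hP he _ h3P h9 x hx
  classical
  -- `ζ² + ζ + 1 = 0` in `𝓞 F`, and its image `ζL ∈ 𝓞 L`
  have hζ : ζ ^ 2 + ζ + 1 = 0 := by
    apply RingOfIntegers.ext
    have h : ((ζ : F) - 1) * ((ζ : F) ^ 2 + (ζ : F) + 1) = 0 := by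
      linear_combination hζ3
    have h' := (mul_eq_zero.mp h).resolve_left (sub_ne_zero.mpr hζ1)
    simpa using h'
  let ζL : 𝓞 L := algebraMap (𝓞 F) (𝓞 L) ζ
  have hζL : ζL ^ 2 + ζL + 1 = 0 := by
    have h := congrArg (algebraMap (𝓞 F) (𝓞 L)) hζ
    rwa [map_add, map_add, map_pow, map_one, map_zero] at h
  have hζLu : IsUnit ζL :=
    isUnit_iff_exists_inv.mpr ⟨-ζL - 1, by linear_combination (-1 : 𝓞 L) * hζL⟩
  have hcoeζ : algebraMap F L (ζ : F) = ((ζL : 𝓞 L) : L) :=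
    (IsScalarTower.algebraMap_apply (𝓞 F) F L ζ).symm.trans
      (IsScalarTower.algebraMap_apply (𝓞 F) (𝓞 L) L ζ)
  -- the prime `P` as a height-one prime; `Gal(L/F)` acts trivially modulo `P`
  haveI := hP
  have hP0 : P ≠ ⊥ := Ideal.IsMaximal.ne_bot_of_isIntegral_int P
  let v : HeightOneSpectrum (𝓞 L) := ⟨P, hP.isPrime, hP0⟩
  have hinert : ∀ (σ : L ≃ₐ[F] L) (y : 𝓞 L), σ • y - y ∈ v.asIdeal :=
    smul_sub_mem_of_ramificationIdx_eq_three h3 P he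
  -- `x` is a `P`-unit, so `x = n / d` with `d ∉ P`
  have hv1 : v.valuation L x = 1 :=
    valuation_eq_one_of_norm_eq_unit v hinert hζLu (by rw [hx, hcoeζ])
  obtain ⟨n, d, hnd⟩ := v.exists_primeCompl_mul_eq_of_integer x hv1.le
  -- norms: `ζ · N(d) = N(n)`, written in `𝓞 L` as products of conjugates
  have hN : algebraMap F L (ζ : F) * algebraMap F L (Algebra.norm F (algebraMap (𝓞 L) L d)) =
      algebraMap F L (Algebra.norm F (algebraMap (𝓞 L) L n)) := by
    rw [← map_mul, ← hx, ← map_mul, hnd]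
  rw [Algebra.norm_eq_prod_automorphisms, Algebra.norm_eq_prod_automorphisms, hcoeζ] at hN
  have hN' : ζL * ∏ σ : L ≃ₐ[F] L, σ • (d : 𝓞 L) = ∏ σ : L ≃ₐ[F] L, σ • n := by
    apply FaithfulSMul.algebraMap_injective (𝓞 L) L
    rw [map_mul, map_prod, map_prod]
    exact hN
  -- reduce modulo `P`: every `σ` acts trivially
  have hmk : ∀ (σ : L ≃ₐ[F] L) (r : 𝓞 L),
      Ideal.Quotient.mk v.asIdeal (σ • r) = Ideal.Quotient.mk v.asIdeal r :=
    fun σ r => Ideal.Quotient.eq.mpr (hinert σ r)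
  have hG : Fintype.card (L ≃ₐ[F] L) = 3 := by
    rw [Fintype.card_eq_nat_card, IsGalois.card_aut_eq_finrank, h3]
  have hq := congrArg (Ideal.Quotient.mk v.asIdeal) hN'
  simp only [map_mul, map_prod, hmk, Finset.prod_const, Finset.card_univ, hG] at hq
  -- in the finite residue field `𝓞 L ⧸ P`, `ζ = (n/d)³` with `ζ` of order `3`
  haveI : Finite (𝓞 L ⧸ v.asIdeal) := Ideal.finiteQuotientOfFreeOfNeBot P hP0
  letI : Fintype (𝓞 L ⧸ v.asIdeal) := Fintype.ofFinite _
  letI : Field (𝓞 L ⧸ v.asIdeal) := Ideal.Quotient.field v.asIdeal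
  have hd : Ideal.Quotient.mk v.asIdeal (d : 𝓞 L) ≠ 0 := by
    rw [Ne, Ideal.Quotient.eq_zero_iff_mem]
    exact d.2
  have h3L : (3 : 𝓞 L) ∉ v.asIdeal := fun h =>
    h3P (by rw [Ideal.mem_comap, map_ofNat]; exact h)
  have hω : orderOf (Ideal.Quotient.mk v.asIdeal ζL) = 3 :=
    orderOf_mk_eq_three_of_notMem hζL _ h3L
  have h9' := nine_dvd_card_sub_one_of_pow_three_eq hω
    (c := Ideal.Quotient.mk v.asIdeal n * (Ideal.Quotient.mk v.asIdeal (d : 𝓞 L))⁻¹)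
    (by rw [mul_pow, ← hq, inv_pow, mul_inv_cancel_right₀ (pow_ne_zero 3 hd)])
  rw [Fintype.card_eq_nat_card] at h9'
  exact h9 (card_quot_eq_of_ramificationIdx_eq_three h3 P he ▸ h9')

end Summit.QuantumAdvantage.QuantumAdvantage.Theorems.LinnikCubicClassGroups
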